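import Literature.MathematicalPhysics.QuantumManyBody.JelliumBoseGas
import Literature.MathematicalPhysics.QuantumManyBody.LiebYngvasonCellMethod
import Mathlib.MeasureTheory.Constructions.HaarToSphere
import Mathlib.MeasureTheory.Measure.Lebesgue.VolumeOfBalls
import Mathlib.Analysis.SpecialFunctions.Integrals.Basic
import HarnessLib

/-!
# Foldy's law for bosonic jellium — proved steps

Topic `Literature/MathematicalPhysics/QuantumManyBody`, companion of `JelliumBoseGas.lean`
(provefact `Literature.MathematicalPhysics.QuantumManyBody.JelliumBoseGas.foldyLaw`,
[LSSY2005, Thm. 10.1]). The named fact `foldyLaw` combines three long published arguments — the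
thermodynamic limit for Dirichlet jellium [LiebNarnhofer1975], the Lieb–Solovej lower bound
[LiebSolovej2001] and Solovej's upper bound [Solovej2006] — none of which has any support in
Mathlib (no Fock space, no Bogoliubov transformation, no localization of many-body Coulomb
systems). This file lands the steps of the eventual proof that ARE elementary, fully proved:

* `BoseGas.lintegral_kineticDensity_lt_top` — a compactly supported `C¹` wave function has finite
  kinetic energy `∫ |∇Ψ|² < ∞` (bounded continuous gradient on a compact set).
* `BoseGas.exists_symm_separated_bump` and `BoseGas.TrialState.exists_separated` — for EVERY
  `N ≥ 1` and `L > 0` there is an admissible (Bose-symmetric, `C¹`, Dirichlet, normalised) trial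
  state in `Λ_L^N` whose particles are pairwise separated on its support (`|xᵢ - xⱼ| ≥ δ > 0`
  whenever `Ψ(X) ≠ 0`), with bounded wave function and finite kinetic energy: the symmetrised
  product ("permanent") of `N` disjoint translates of one bump function placed along a row of the
  box. (`BoseEinsteinCondensation.lean` had non-vacuity only for `N = 1`.)
* `JelliumBoseGas.chargedGroundStateEnergy_lt_top` / `…_ne_top` /
  `eventually_chargedGroundStateEnergy_ne_top` — the **first conjunct of `foldyLaw`**: the charged
  (jellium) ground-state energy in the tree's `ℝ≥0∞` vocabulary is finite for every `N ≥ 1`,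
  `L > 0`, coupling `q` and background density `ρ_b ≥ 0` (on the separated state the Coulomb
  repulsion is bounded by `N² δ⁻¹`, the shifted background term by `6π ρ_b N L²`).
* `JelliumBoseGas.foldyLaw_of_tendsto` — the **assembly step** of [LSSY2005, Thm. 10.1]: the
  `ε`–`ρ₀`–eventually-in-`N` statement `foldyLaw` follows from (i) the existence of the
  thermodynamic limit `e(q, ρ)` of the neutral-jellium energy per particle along `N → ∞`,
  `L = (N/ρ)^{1/3}` [LiebNarnhofer1975; LSSY2005 §10.1 "we know from the work in [LN] that the
  thermodynamic limit e₀(ρ) … exists"] and (ii) the printed limit form (10.2),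
  `lim_{ρ→∞} ρ^{-1/4} e(q, ρ) = -foldyConstant · q^{5/4}` (tree units `μ = 1`, coupling `q`).
  What remains for `foldyLaw_holds` is exactly (i) and (ii).
* `JelliumBoseGas.foldyLaw_iff_bounds` / `foldyLaw_of_bounds` — sharper: `foldyLaw` is EQUIVALENT
  to the conjunction of a finite-volume lower bound of the shape of [LiebSolovej2001, Thm. 1.1]
  and a finite-volume upper bound of the shape of [Solovej2006, Thm. 1.1] (both `ε`–`ρ₀`–
  eventually-in-`N`); the thermodynamic limit [LiebNarnhofer1975] is not needed for the `ε`-form.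
* `JelliumBoseGas.integral_inv_norm_ball` (`∫_{|z|<R} |z|⁻¹ dz = 2πR²` in `ℝ³`, polar
  coordinates), `integrableOn_inv_norm_sub_box` (local integrability of the Coulomb singularity),
  `backgroundPotential_le` (**`V₁(x) = ∫_Λ |x-y|⁻¹ dy ≤ 6πL²` for `x ∈ Λ_L`**, via
  `Λ_L ⊂ B(x, √3 L)`), and the clipping-free identity `jelliumInteraction_eq_ofReal` /
  `shiftedCoulomb_eq`: on `Λ_L^N` the tree's `ℝ≥0∞` jellium energy is `ofReal` of LSSY's Coulomb
  energy `U` of (10.1) (unit charge) plus `jelliumEnergyShift 1 ρ_b N L` — the dictionary between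
  `chargedEnergy` and `⟨Ψ, H_N^{(1)} Ψ⟩` asserted in the docstrings of `JelliumBoseGas.lean`.

## References

* [LSSY2005] E. H. Lieb, R. Seiringer, J. P. Solovej, J. Yngvason, *The Mathematics of the Bose
  Gas and its Condensation*, Birkhäuser 2005 (arXiv:cond-mat/0610117): Ch. 10 (arXiv Ch. 12),
  (10.1), Thm. 10.1 with (10.2); Ch. 2 (2.2).
* [LiebNarnhofer1975] E. H. Lieb, H. Narnhofer, J. Stat. Phys. 12 (1975) 291–310.
* [LiebSolovej2001] E. H. Lieb, J. P. Solovej, Commun. Math. Phys. 217 (2001) 127–163;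
  Errata 225 (2002) 219–221.
* [Solovej2006] J. P. Solovej, Commun. Math. Phys. 266 (2006) 797–818.
-/

noncomputable section

open MeasureTheory Filter Metric
open scoped ENNReal NNReal Topology

namespace Literature.MathematicalPhysics.QuantumManyBody.BoseGas

variable {N : ℕ}

/-! ### Finite kinetic energy of compactly supported `C¹` wave functions -/

/-- Pointwise bound: if `‖∇Ψ(X)‖ ≤ C` (operator norm of the Fréchet derivative) then the kinetic
energy density `∑ᵢ ∑ₖ |∂_{i,k} Ψ(X)|²` is at most `3 N C²`. [folklore] -/
theorem kineticDensity_le_of_norm_fderiv_le {ψ : Config N → ℂ} {X : Config N} {C : ℝ}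
    (hC : ‖fderiv ℝ ψ X‖ ≤ C) :
    kineticDensity ψ X ≤ (N : ℝ≥0∞) * (3 * ENNReal.ofReal C ^ 2) := by
  unfold kineticDensity
  have hC0 : 0 ≤ C := (norm_nonneg _).trans hC
  calc ∑ i : Fin N, ∑ k : Fin 3,
        (‖fderiv ℝ ψ X (Pi.single i (EuclideanSpace.single k (1 : ℝ)))‖₊ : ℝ≥0∞) ^ 2
      ≤ ∑ _i : Fin N, ∑ _k : Fin 3, ENNReal.ofReal C ^ 2 := by
        gcongr with i _ k _
        rw [← enorm_eq_nnnorm, ← ofReal_norm]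
        refine ENNReal.ofReal_le_ofReal ?_
        calc ‖fderiv ℝ ψ X (Pi.single i (EuclideanSpace.single k (1 : ℝ)))‖
            ≤ ‖fderiv ℝ ψ X‖ * ‖(Pi.single i (EuclideanSpace.single k (1 : ℝ)) : Config N)‖ :=
              ContinuousLinearMap.le_opNorm _ _
          _ ≤ C * 1 := by
              gcongr
              rw [Pi.norm_single, EuclideanSpace.single, PiLp.norm_single, norm_one]
          _ = C := mul_one C
    _ = (N : ℝ≥0∞) * (3 * ENNReal.ofReal C ^ 2) := by
        simp only [Finset.sum_const, Finset.card_univ, Fintype.card_fin, nsmul_eq_mul]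
        push_cast
        ring

/-- Off the topological support of `Ψ` the kinetic energy density vanishes. [folklore] -/
theorem kineticDensity_eq_zero_of_notMem_tsupport {ψ : Config N → ℂ} {X : Config N}
    (hX : X ∉ tsupport ψ) : kineticDensity ψ X = 0 := by
  unfold kineticDensity
  simp [fderiv_of_notMem_tsupport ℝ hX]

/-- **Finite kinetic energy.** A `C¹` wave function with compact support has
`∫ ∑ᵢ |∇ᵢ Ψ|² < ∞`: its gradient is continuous and compactly supported, hence bounded, and the
density vanishes off the (compact, finite-measure) support. [folklore] -/
theorem lintegral_kineticDensity_lt_top {ψ : Config N → ℂ} (hψ : ContDiff ℝ 1 ψ)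
    (hsupp : HasCompactSupport ψ) : ∫⁻ X, kineticDensity ψ X < ⊤ := by
  obtain ⟨C, hC⟩ :=
    (hψ.continuous_fderiv one_ne_zero).bounded_above_of_compact_support (hsupp.fderiv ℝ)
  have hsub : Function.support (kineticDensity ψ) ⊆ tsupport ψ := fun X hX => by
    by_contra h
    exact hX (kineticDensity_eq_zero_of_notMem_tsupport h)
  rw [← setLIntegral_eq_of_support_subset hsub]
  calc ∫⁻ X in tsupport ψ, kineticDensity ψ X
      ≤ ∫⁻ _X in tsupport ψ, (N : ℝ≥0∞) * (3 * ENNReal.ofReal C ^ 2) :=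
        setLIntegral_mono measurable_const fun X _ => kineticDensity_le_of_norm_fderiv_le (hC X)
    _ = (N : ℝ≥0∞) * (3 * ENNReal.ofReal C ^ 2) * volume (tsupport ψ) := setLIntegral_const _ _
    _ < ⊤ := by
        refine ENNReal.mul_lt_top ?_ hsupp.isCompact.measure_lt_top
        exact ENNReal.mul_lt_top (ENNReal.natCast_lt_top N)
          (ENNReal.mul_lt_top (by norm_num) (ENNReal.pow_lt_top ENNReal.ofReal_lt_top))

/-- A wave function vanishing off the `N`-particle box has compact support. [folklore] -/
theorem hasCompactSupport_of_eq_zero_boxN {ψ : Config N → ℂ} {L : ℝ}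
    (h0 : ∀ X, X ∉ boxN N L → ψ X = 0) : HasCompactSupport ψ :=
  HasCompactSupport.intro (isCompact_closedBall (0 : Config N) (3 * |L|)) fun X hX =>
    h0 X fun hX' => hX (boxN_subset_closedBall N L hX')

/-- In particular every admissible trial state has finite kinetic energy. [folklore] -/
theorem TrialState.lintegral_kineticDensity_lt_top {L : ℝ} (Ψ : TrialState N L) :
    ∫⁻ X, kineticDensity Ψ.ψ X < ⊤ :=
  BoseGas.lintegral_kineticDensity_lt_top Ψ.contDiff (hasCompactSupport_of_eq_zero_boxN Ψ.eq_zero)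

/-! ### Symmetric trial states with pairwise separated particles, for every `N` -/

/-- **Separated symmetric bump.** For `N ≥ 1` particles in the box `Λ_L`, `L > 0`, there is a
real `C¹` function `F` on `(ℝ³)^N` and `δ > 0` such that: `F` vanishes off the open box `Λ_L^N`,
is symmetric under permutations of the particles, takes values in `[0, N!]`, is `≥ 1` on a ball,
and on its support the particles are pairwise `δ`-separated. Construction: put `N` disjoint
translates `f(· - pₖ)` of one bump function (radii `δ = s/8 < s/4`, `s = L/(N+1)`) at the points
`pₖ = (s(k+1), L/2, L/2)` and take the permanent `F(X) = ∑_σ ∏ᵢ f(xᵢ - p_{σ i})`. [folklore] -/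
theorem exists_symm_separated_bump (hN : 0 < N) {L : ℝ} (hL : 0 < L) :
    ∃ (F : Config N → ℝ) (δ : ℝ), 0 < δ ∧ ContDiff ℝ 1 F ∧
      (∀ X, X ∉ boxN N L → F X = 0) ∧
      (∀ (σ : Equiv.Perm (Fin N)) (X : Config N), F (X ∘ σ) = F X) ∧
      (∀ X, 0 ≤ F X) ∧ (∀ X, F X ≤ Fintype.card (Equiv.Perm (Fin N))) ∧
      (∀ X, F X ≠ 0 → ∀ i j, i ≠ j → δ ≤ dist (X i) (X j)) ∧
      ∃ X₀ : Config N, ∀ X ∈ closedBall X₀ δ, 1 ≤ F X := by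
  -- spacing and centres
  set s : ℝ := L / (N + 1) with hs_def
  have hs0 : 0 < s := by positivity
  have hsN : s * (N + 1) = L := by rw [hs_def]; field_simp
  have hsL : s ≤ L / 2 := by
    rw [hs_def, div_le_div_iff₀ (by positivity) (by positivity)]
    have : (2 : ℝ) ≤ N + 1 := by
      have : (1 : ℝ) ≤ N := Nat.one_le_cast.2 hN
      linarith
    nlinarith
  let p : Fin N → Space := fun i =>
    WithLp.toLp 2 (fun k : Fin 3 => if k = 0 then s * ((i : ℝ) + 1) else L / 2)
  have hp0 : ∀ i, p i 0 = s * ((i : ℝ) + 1) := fun i => by simp [p]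
  have hpk : ∀ i (k : Fin 3), k ≠ 0 → p i k = L / 2 := fun i k hk => by simp [p, hk]
  -- centres are `s`-separated
  have hsep : ∀ i j : Fin N, i ≠ j → s ≤ dist (p i) (p j) := by
    intro i j hij
    have hij' : (i : ℕ) ≠ j := Fin.val_ne_of_ne hij
    have h1 : (1 : ℝ) ≤ |((i : ℕ) : ℝ) - ((j : ℕ) : ℝ)| := by
      rcases Nat.lt_or_gt_of_ne hij' with h | h
      · have : ((i : ℕ) : ℝ) + 1 ≤ ((j : ℕ) : ℝ) := by exact_mod_cast h
        rw [abs_sub_comm, abs_of_nonneg (by linarith)]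
        linarith
      · have : ((j : ℕ) : ℝ) + 1 ≤ ((i : ℕ) : ℝ) := by exact_mod_cast h
        rw [abs_of_nonneg (by linarith)]
        linarith
    calc s = s * 1 := (mul_one s).symm
      _ ≤ s * |((i : ℕ) : ℝ) - ((j : ℕ) : ℝ)| := by gcongr
      _ = |p i 0 - p j 0| := by rw [hp0, hp0, ← mul_sub, abs_mul, abs_of_pos hs0]; ring_nf
      _ = dist (p i 0) (p j 0) := (Real.dist_eq _ _).symm
      _ ≤ dist (p i) (p j) := PiLp.dist_apply_le (p i) (p j) 0
  -- the balls of radius `s/4` about the centres lie in the box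
  have hball : ∀ (i : Fin N) (y : Space), dist y (p i) < s / 4 → y ∈ box L := by
    intro i y hy k
    have hk : |y k - p i k| < s / 4 := by
      rw [← Real.dist_eq]; exact (PiLp.dist_apply_le y (p i) k).trans_lt hy
    rw [abs_lt] at hk
    by_cases hk0 : k = 0
    · subst hk0
      rw [hp0] at hk
      have hi1 : (1 : ℝ) ≤ (i : ℝ) + 1 := by
        have : (0 : ℝ) ≤ (i : ℝ) := Nat.cast_nonneg _
        linarith
      have hi2 : (i : ℝ) + 1 ≤ N := by exact_mod_cast i.is_lt
      have hlo : s ≤ s * ((i : ℝ) + 1) := le_mul_of_one_le_right hs0.le hi1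
      have hhi : s * ((i : ℝ) + 1) ≤ s * N := mul_le_mul_of_nonneg_left hi2 hs0.le
      have hsNL : s * N = L - s := by linarith [hsN, mul_add s (N : ℝ) 1]
      constructor <;> nlinarith
    · rw [hpk i k hk0] at hk
      constructor <;> nlinarith
  -- one bump profile, translated
  let f : ContDiffBump (0 : Space) := ⟨s / 8, s / 4, by positivity, by linarith⟩
  have hf_supp : ∀ y : Space, f y ≠ 0 → ‖y‖ < s / 4 := by
    intro y hy
    have : y ∈ Function.support (f : Space → ℝ) := hy
    rw [f.support_eq] at this
    simpa using this
  have hf_one : ∀ y : Space, ‖y‖ ≤ s / 8 → f y = 1 := fun y hy =>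
    f.one_of_mem_closedBall (by simpa using hy)
  -- the permanent
  let F : Config N → ℝ := fun X => ∑ σ : Equiv.Perm (Fin N), ∏ i, f (X i - p (σ i))
  have hterm_nonneg : ∀ (σ : Equiv.Perm (Fin N)) (X : Config N),
      0 ≤ ∏ i, f (X i - p (σ i)) := fun σ X => Finset.prod_nonneg fun i _ => f.nonneg
  have hterm_le : ∀ (σ : Equiv.Perm (Fin N)) (X : Config N), ∏ i, f (X i - p (σ i)) ≤ 1 :=
    fun σ X => Finset.prod_le_one (fun i _ => f.nonneg) fun i _ => f.le_one
  refine ⟨F, s / 8, by positivity, ?_, ?_, ?_, ?_, ?_, ?_, ?_⟩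
  · -- C¹
    refine ContDiff.sum fun σ _ => contDiff_prod fun i _ => ?_
    exact f.contDiff.comp ((contDiff_apply ℝ Space i).sub contDiff_const)
  · -- vanishing off the box
    intro X hX
    simp only [boxN, Set.mem_setOf_eq, not_forall] at hX
    obtain ⟨i, hi⟩ := hX
    refine Finset.sum_eq_zero fun σ _ => Finset.prod_eq_zero (Finset.mem_univ i) ?_
    by_contra h
    exact hi (hball (σ i) (X i) (by rw [dist_eq_norm]; exact hf_supp _ h))
  · -- symmetry
    intro τ X
    simp only [F, Function.comp_apply]
    refine Fintype.sum_equiv (Equiv.mulRight τ⁻¹) _ _ fun σ => ?_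
    simp only [Equiv.coe_mulRight, Equiv.Perm.mul_apply]
    exact Fintype.prod_equiv τ _ _ fun i => by simp
  · exact fun X => Finset.sum_nonneg fun σ _ => hterm_nonneg σ X
  · intro X
    calc F X ≤ ∑ _σ : Equiv.Perm (Fin N), (1 : ℝ) := Finset.sum_le_sum fun σ _ => hterm_le σ X
      _ = Fintype.card (Equiv.Perm (Fin N)) := by simp
  · -- separation on the support
    intro X hX i j hij
    obtain ⟨σ, -, hσ⟩ := Finset.exists_ne_zero_of_sum_ne_zero hX
    have hin : ∀ k, dist (X k) (p (σ k)) < s / 4 := fun k => by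
      rw [dist_eq_norm]
      exact hf_supp _ (Finset.prod_ne_zero_iff.1 hσ k (Finset.mem_univ k))
    have hσij : σ i ≠ σ j := fun h => hij (σ.injective h)
    have h4 := dist_triangle4 (p (σ i)) (X i) (X j) (p (σ j))
    have := hsep _ _ hσij
    have hi := hin i
    have hj := hin j
    rw [dist_comm] at hi
    linarith
  · -- `F ≥ 1` near the configuration of centres
    refine ⟨fun i => p i, fun X hX => ?_⟩
    have hX' : ∀ i, ‖X i - p i‖ ≤ s / 8 := fun i => by
      rw [← dist_eq_norm]; exact (dist_le_pi_dist X (fun i => p i) i).trans (mem_closedBall.1 hX)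
    calc (1 : ℝ) = ∏ i : Fin N, f (X i - p ((1 : Equiv.Perm (Fin N)) i)) := by
          rw [Finset.prod_eq_one fun i _ => ?_]
          rw [Equiv.Perm.coe_one, id_eq]
          exact hf_one _ (hX' i)
      _ ≤ F X := Finset.single_le_sum (f := fun σ : Equiv.Perm (Fin N) => ∏ i, f (X i - p (σ i)))
          (fun σ _ => hterm_nonneg σ X) (Finset.mem_univ 1)

/-- **Admissible trial states exist for every `N ≥ 1`, `L > 0`, with separated particles.**
There is `Ψ ∈ TrialState N L` (Bose-symmetric, `C¹`, Dirichlet, `‖Ψ‖₂ = 1`) together with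
`δ > 0` and a bound `B` such that `|Ψ| ≤ B` everywhere and `|xᵢ - xⱼ| ≥ δ` for all `i ≠ j`
wherever `Ψ(X) ≠ 0` (normalise `exists_symm_separated_bump`). [folklore] -/
theorem TrialState.exists_separated (hN : 0 < N) {L : ℝ} (hL : 0 < L) :
    ∃ (Ψ : TrialState N L) (δ B : ℝ), 0 < δ ∧
      (∀ X, ‖Ψ.ψ X‖ ≤ B) ∧ (∀ X, Ψ.ψ X ≠ 0 → ∀ i j, i ≠ j → δ ≤ dist (X i) (X j)) := by
  obtain ⟨F, δ, hδ, hF, h0, hsymm, hnn, hle, hsepF, X₀, hX₀⟩ := exists_symm_separated_bump hN hL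
  let φ : Config N → ℂ := fun X => (F X : ℂ)
  have hφ : ContDiff ℝ 1 φ := Complex.ofRealCLM.contDiff.comp hF
  have hφ0 : ∀ X, X ∉ boxN N L → φ X = 0 := fun X hX => by simp [φ, h0 X hX]
  set m : ℝ≥0∞ := ∫⁻ X, (‖φ X‖₊ : ℝ≥0∞) ^ 2 with hm_def
  have hsup : Function.support (fun X => (‖φ X‖₊ : ℝ≥0∞) ^ 2) ⊆ boxN N L := by
    intro X hX
    by_contra h
    exact hX (by simp [hφ0 X h])
  have hmtop : m ≠ ⊤ := by
    rw [hm_def, ← setLIntegral_eq_of_support_subset hsup]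
    exact (lintegral_boxN_normSq_lt_top hφ.continuous L).ne
  have hm0 : m ≠ 0 := by
    have h1 : volume (closedBall X₀ δ) ≤ m := by
      calc volume (closedBall X₀ δ) = ∫⁻ X in closedBall X₀ δ, 1 := (setLIntegral_one _).symm
        _ ≤ ∫⁻ X in closedBall X₀ δ, (‖φ X‖₊ : ℝ≥0∞) ^ 2 := by
            refine setLIntegral_mono' measurableSet_closedBall fun X hX => ?_
            have h1 : (1 : ℝ) ≤ ‖φ X‖ := by
              simp only [φ, Complex.norm_real, Real.norm_eq_abs]
              exact (hX₀ X hX).trans (le_abs_self _)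
            calc (1 : ℝ≥0∞) = ENNReal.ofReal 1 ^ 2 := by simp
              _ ≤ ENNReal.ofReal ‖φ X‖ ^ 2 := by gcongr
              _ = (‖φ X‖₊ : ℝ≥0∞) ^ 2 := by rw [ofReal_norm, enorm_eq_nnnorm]
        _ ≤ m := setLIntegral_le_lintegral _ _
    have h2 : 0 < volume (closedBall X₀ δ) := measure_closedBall_pos volume X₀ hδ
    exact (h2.trans_le h1).ne'
  have hmpos : 0 < m.toReal := ENNReal.toReal_pos hm0 hmtop
  set c : ℝ := Real.sqrt (m.toReal)⁻¹ with hc_def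
  have hc0 : 0 ≤ c := Real.sqrt_nonneg _
  have hc2 : ENNReal.ofReal (c ^ 2) = m⁻¹ := by
    rw [hc_def, Real.sq_sqrt (inv_nonneg.2 hmpos.le), ENNReal.ofReal_inv_of_pos hmpos,
      ENNReal.ofReal_toReal hmtop]
  let Ψ : TrialState N L :=
    { ψ := fun X => (c : ℂ) * φ X
      contDiff := contDiff_const.mul hφ
      eq_zero := fun X hX => by simp [hφ0 X hX]
      symm := fun σ X => by
        show (c : ℂ) * φ (X ∘ σ) = c * φ X
        simp only [φ, hsymm]
      norm_eq := by
        simp only [ennorm_real_mul_sq c hc0]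
        rw [lintegral_const_mul' _ _ ENNReal.ofReal_ne_top, hc2]
        exact ENNReal.inv_mul_cancel hm0 hmtop }
  refine ⟨Ψ, δ, c * Fintype.card (Equiv.Perm (Fin N)), hδ, fun X => ?_, fun X hX => ?_⟩
  · show ‖(c : ℂ) * φ X‖ ≤ c * Fintype.card (Equiv.Perm (Fin N))
    rw [norm_mul, Complex.norm_real, Real.norm_of_nonneg hc0]
    refine mul_le_mul_of_nonneg_left ?_ hc0
    simp only [φ, Complex.norm_real, Real.norm_eq_abs, abs_of_nonneg (hnn X)]
    exact hle X
  · have : F X ≠ 0 := by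
      intro h
      apply hX
      show (c : ℂ) * φ X = 0
      simp [φ, h]
    exact hsepF X this

/-- Consequently the class of admissible trial states is inhabited for every `N ≥ 1` and
`L > 0` (not only for `N = 1`, `TrialState.nonempty_one`). [folklore] -/
theorem TrialState.nonempty (hN : 0 < N) {L : ℝ} (hL : 0 < L) : Nonempty (TrialState N L) := by
  obtain ⟨Ψ, -⟩ := TrialState.exists_separated hN hL
  exact ⟨Ψ⟩

end Literature.MathematicalPhysics.QuantumManyBody.BoseGas

namespace Literature.MathematicalPhysics.QuantumManyBody.JelliumBoseGas

open BoseGas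

variable {N : ℕ}

/-! ### Conjunct 1 of Foldy's law: the charged ground-state energy is finite -/

/-- On a configuration whose particles are pairwise `δ`-separated, the (shifted, unit-charge)
jellium energy is at most `∑_{i<j} δ⁻¹ + N · ρ_b · 6πL²` (for `ρ_b ≥ 0`; the background
potential `∫_Λ |x - y|⁻¹ dy` is nonnegative). [cite: LSSY2005, Ch. 10 (10.1)] -/
theorem jelliumInteraction_le_of_separated {ρb : ℝ} (hρ : 0 ≤ ρb) (L : ℝ) {δ : ℝ} (hδ : 0 < δ)
    {X : Config N} (hX : ∀ i j, i ≠ j → δ ≤ dist (X i) (X j)) :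
    jelliumInteraction ρb N L X ≤
      (∑ i : Fin N, ∑ j : Fin N with i < j, ENNReal.ofReal δ⁻¹) +
        ∑ _i : Fin N, ENNReal.ofReal (ρb * (6 * Real.pi * L ^ 2)) := by
  unfold jelliumInteraction
  gcongr with i _ j hj i' _
  · have hij : i ≠ j := ne_of_lt (Finset.mem_filter.1 hj).2
    rw [← dist_eq_norm]
    exact hX i j hij
  · exact sub_le_self _ (integral_nonneg fun y => inv_nonneg.2 (norm_nonneg _))

/-- **The charged ground-state energy is finite** for every `N ≥ 1`, `L > 0`, coupling `q` and
background density `ρ_b ≥ 0`: the separated trial state of `TrialState.exists_separated` has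
finite kinetic energy and, its particles being `δ`-separated on its support, Coulomb energy at
most `∑_{i<j} δ⁻¹ + 6π ρ_b N L²`. [cite: LSSY2005, Ch. 10 (10.1) and (2.3)] -/
theorem chargedGroundStateEnergy_lt_top (hN : 0 < N) {L : ℝ} (hL : 0 < L) (q : ℝ) {ρb : ℝ}
    (hρ : 0 ≤ ρb) : chargedGroundStateEnergy 0 q ρb N L < ⊤ := by
  obtain ⟨Ψ, δ, B, hδ, -, hsep⟩ := TrialState.exists_separated hN hL
  refine (chargedGroundStateEnergy_le_chargedEnergy 0 q ρb Ψ).trans_lt ?_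
  -- the constant bounding the jellium energy on the support
  set M : ℝ≥0∞ := (∑ i : Fin N, ∑ j : Fin N with i < j, ENNReal.ofReal δ⁻¹) +
    ∑ _i : Fin N, ENNReal.ofReal (ρb * (6 * Real.pi * L ^ 2)) with hM_def
  have hMtop : M ≠ ⊤ := by
    refine ENNReal.add_ne_top.2 ⟨?_, ?_⟩
    · exact ENNReal.sum_ne_top.2 fun i _ => ENNReal.sum_ne_top.2 fun j _ => ENNReal.ofReal_ne_top
    · exact ENNReal.sum_ne_top.2 fun _ _ => ENNReal.ofReal_ne_top
  have hpt : ∀ X, jelliumInteraction ρb N L X * (‖Ψ.ψ X‖₊ : ℝ≥0∞) ^ 2 ≤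
      M * (‖Ψ.ψ X‖₊ : ℝ≥0∞) ^ 2 := by
    intro X
    by_cases hX : Ψ.ψ X = 0
    · simp [hX]
    · exact mul_le_mul_of_nonneg_right
        (jelliumInteraction_le_of_separated hρ L hδ (hsep X hX)) bot_le
  have hcoul : ∫⁻ X, jelliumInteraction ρb N L X * (‖Ψ.ψ X‖₊ : ℝ≥0∞) ^ 2 ≤ M := by
    calc ∫⁻ X, jelliumInteraction ρb N L X * (‖Ψ.ψ X‖₊ : ℝ≥0∞) ^ 2
        ≤ ∫⁻ X, M * (‖Ψ.ψ X‖₊ : ℝ≥0∞) ^ 2 := lintegral_mono hpt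
      _ = M := by rw [lintegral_const_mul' _ _ hMtop, Ψ.norm_eq, mul_one]
  have hkin : energy 0 Ψ < ⊤ := by
    have : energy 0 Ψ = ∫⁻ X, kineticDensity Ψ.ψ X := by
      simp [energy, interaction]
    rw [this]
    exact Ψ.lintegral_kineticDensity_lt_top
  unfold chargedEnergy
  exact ENNReal.add_lt_top.2 ⟨hkin, ENNReal.mul_lt_top ENNReal.ofReal_lt_top
    (hcoul.trans_lt (lt_top_iff_ne_top.2 hMtop))⟩

/-- The charged ground-state energy is finite (`≠ ⊤` form). [cite: LSSY2005, Ch. 10 (10.1) and (2.3)] -/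
theorem chargedGroundStateEnergy_ne_top (hN : 0 < N) {L : ℝ} (hL : 0 < L) (q : ℝ) {ρb : ℝ}
    (hρ : 0 ≤ ρb) : chargedGroundStateEnergy 0 q ρb N L ≠ ⊤ :=
  (chargedGroundStateEnergy_lt_top hN hL q hρ).ne

/-- **Conjunct 1 of `foldyLaw`.** At every density `ρ > 0` and coupling `q`, for all `N ≥ 1`
(in particular eventually), the neutral-jellium ground-state energy in the box of side
`(N/ρ)^{1/3}` is finite. [cite: LSSY2005, Ch. 10 (10.1) and (2.2)] -/
theorem eventually_chargedGroundStateEnergy_ne_top {ρ : ℝ} (hρ : 0 < ρ) (q : ℝ) :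
    ∀ᶠ N : ℕ in atTop, chargedGroundStateEnergy 0 q ρ N (sideLength ρ N) ≠ ⊤ := by
  filter_upwards [eventually_gt_atTop 0] with N hN
  exact chargedGroundStateEnergy_ne_top hN
    (Real.rpow_pos_of_pos (div_pos (Nat.cast_pos.2 hN) hρ) _) q hρ.le

/-! ### The assembly step of Theorem 10.1 -/

/-- **Foldy's law from the thermodynamic limit and the printed limit form (10.2).** Suppose that
for every coupling `q > 0` there are a function `e = e(q, ·)` and a threshold `ρ₁` such that
(i) for every `ρ ≥ ρ₁` the neutral-jellium ground-state energy per particle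
`(E₀(N, L) - shift)/N`, `L = (N/ρ)^{1/3}`, converges to `e ρ` as `N → ∞` (existence of the
thermodynamic limit (2.2), [LiebNarnhofer1975]) and (ii) `ρ^{-1/4} e ρ → -foldyConstant · q^{5/4}`
as `ρ → ∞` ([LSSY2005, Thm. 10.1 (10.2)] in the tree's units). Then `foldyLaw` holds: given
`ε > 0` take `ρ₀ ≥ max(1, ρ₁)` beyond which `|ρ^{-1/4} e ρ + foldyConstant q^{5/4}| < ε/2`, and for
`ρ ≥ ρ₀` combine with `|E₀/N - e ρ| < (ε/2) ρ^{1/4}` for large `N` and with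
`eventually_chargedGroundStateEnergy_ne_top`. [cite: LSSY2005, Thm. 10.1 and §10.1 (2.2)] -/
theorem foldyLaw_of_tendsto
    (h : ∀ q : ℝ, 0 < q → ∃ (e : ℝ → ℝ) (ρ₁ : ℝ),
      (∀ ρ : ℝ, ρ₁ ≤ ρ → Tendsto (fun N : ℕ =>
          ((chargedGroundStateEnergy 0 q ρ N (sideLength ρ N)).toReal -
              jelliumEnergyShift q ρ N (sideLength ρ N)) / N) atTop (𝓝 (e ρ))) ∧
      Tendsto (fun ρ : ℝ => ρ ^ (-(1 / 4 : ℝ)) * e ρ) atTop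
        (𝓝 (-(foldyConstant * q ^ (5 / 4 : ℝ))))) :
    foldyLaw := by
  intro q hq ε hε
  obtain ⟨e, ρ₁, hlim, hthm⟩ := h q hq
  have hε2 : 0 < ε / 2 := half_pos hε
  obtain ⟨ρ₂, hρ₂⟩ := Filter.eventually_atTop.1 (Metric.tendsto_nhds.1 hthm _ hε2)
  refine ⟨max 1 (max ρ₁ ρ₂), lt_max_of_lt_left one_pos, fun ρ hρ => ?_⟩
  have hρ0 : 0 < ρ := lt_of_lt_of_le one_pos ((le_max_left _ _).trans hρ)
  have h1 : ρ₁ ≤ ρ := ((le_max_left _ _).trans (le_max_right _ _)).trans hρ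
  have h2 : ρ₂ ≤ ρ := ((le_max_right _ _).trans (le_max_right _ _)).trans hρ
  have hr : 0 < ρ ^ (1 / 4 : ℝ) := Real.rpow_pos_of_pos hρ0 _
  -- (ii): `|e ρ + foldyConstant q^{5/4} ρ^{1/4}| < (ε/2) ρ^{1/4}`
  have hA : |e ρ + foldyConstant * q ^ (5 / 4 : ℝ) * ρ ^ (1 / 4 : ℝ)| < ε / 2 * ρ ^ (1 / 4 : ℝ) := by
    have hd := hρ₂ ρ h2
    rw [Real.dist_eq] at hd
    have key : e ρ + foldyConstant * q ^ (5 / 4 : ℝ) * ρ ^ (1 / 4 : ℝ) =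
        ρ ^ (1 / 4 : ℝ) * (ρ ^ (-(1 / 4 : ℝ)) * e ρ - -(foldyConstant * q ^ (5 / 4 : ℝ))) := by
      rw [Real.rpow_neg hρ0.le, mul_sub, ← mul_assoc, mul_inv_cancel₀ hr.ne', one_mul]
      ring
    rw [key, abs_mul, abs_of_pos hr, mul_comm]
    exact mul_lt_mul_of_pos_right hd hr
  -- (i): `|E₀/N - e ρ| < (ε/2) ρ^{1/4}` eventually
  have hB := Metric.tendsto_nhds.1 (hlim ρ h1) (ε / 2 * ρ ^ (1 / 4 : ℝ)) (by positivity)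
  filter_upwards [hB, eventually_chargedGroundStateEnergy_ne_top hρ0 q] with N hN hfin
  refine ⟨hfin, ?_⟩
  rw [Real.dist_eq] at hN
  set a : ℝ := ((chargedGroundStateEnergy 0 q ρ N (sideLength ρ N)).toReal -
    jelliumEnergyShift q ρ N (sideLength ρ N)) / N
  calc |a + foldyConstant * q ^ (5 / 4 : ℝ) * ρ ^ (1 / 4 : ℝ)|
      = |(a - e ρ) + (e ρ + foldyConstant * q ^ (5 / 4 : ℝ) * ρ ^ (1 / 4 : ℝ))| := by ring_nf
    _ ≤ |a - e ρ| + |e ρ + foldyConstant * q ^ (5 / 4 : ℝ) * ρ ^ (1 / 4 : ℝ)| := abs_add_le _ _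
    _ ≤ ε / 2 * ρ ^ (1 / 4 : ℝ) + ε / 2 * ρ ^ (1 / 4 : ℝ) := add_le_add hN.le hA.le
    _ = ε * ρ ^ (1 / 4 : ℝ) := by ring

section Background

open Set

/-! ### The Coulomb potential of a ball and the background potential bound `V₁ ≤ 6πL²` -/

/-- The Coulomb singularity is integrable on balls about the origin in `ℝ³`:
in polar coordinates the integrand is `r² · r⁻¹ = r`. [folklore] -/
theorem integrableOn_inv_norm_ball (R : ℝ) :
    IntegrableOn (fun z : Space => ‖z‖⁻¹) (ball (0 : Space) R) := by
  have h := (integrableOn_fun_norm_addHaar (volume : Measure Space) (f := fun y : ℝ => y⁻¹)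
    (r := R)).2
  refine h ?_
  rw [finrank_euclideanSpace_fin]
  have : IntegrableOn (fun y : ℝ => y) (Ioo 0 R) :=
    (continuous_id.integrableOn_Icc (a := 0) (b := R)).mono_set Ioo_subset_Icc_self
  refine this.congr_fun (fun y hy => ?_) measurableSet_Ioo
  have hy0 : y ≠ 0 := hy.1.ne'
  simp only [smul_eq_mul]
  field_simp

/-- `∫_{|z| < R} |z|⁻¹ dz = 2π R²` in `ℝ³` (`R ≥ 0`). [folklore] -/
theorem integral_inv_norm_ball {R : ℝ} (hR : 0 ≤ R) :
    ∫ z in ball (0 : Space) R, ‖z‖⁻¹ = 2 * Real.pi * R ^ 2 := by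
  have hind : ∀ z : Space, (Iio R).indicator (fun y : ℝ => y⁻¹) ‖z‖ =
      (ball (0 : Space) R).indicator (fun z => ‖z‖⁻¹) z := by
    intro z
    by_cases hz : ‖z‖ < R
    · rw [indicator_of_mem (mem_Iio.2 hz), indicator_of_mem (mem_ball_zero_iff.2 hz)]
    · rw [indicator_of_notMem (by simpa using hz), indicator_of_notMem (by simpa using hz)]
  have hpolar := integral_fun_norm_addHaar (volume : Measure Space)
    ((Iio R).indicator fun y : ℝ => y⁻¹)
  simp_rw [hind, integral_indicator measurableSet_ball] at hpolar
  rw [hpolar, finrank_euclideanSpace_fin]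
  have hball : (volume : Measure Space).real (ball 0 1) = Real.pi * 4 / 3 := by
    rw [measureReal_def, EuclideanSpace.volume_ball_fin_three]
    simp [ENNReal.toReal_ofReal (by positivity : (0 : ℝ) ≤ Real.pi * 4 / 3)]
  rw [hball]
  have hrad : ∫ y in Ioi (0 : ℝ), y ^ (3 - 1) • (Iio R).indicator (fun y : ℝ => y⁻¹) y =
      R ^ 2 / 2 := by
    have h1 : ∀ y : ℝ, y ^ (3 - 1) • (Iio R).indicator (fun y : ℝ => y⁻¹) y =
        (Iio R).indicator (fun y : ℝ => y ^ 2 * y⁻¹) y := by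
      intro y
      by_cases hy : y ∈ Iio R
      · simp [indicator_of_mem hy]
      · simp [indicator_of_notMem hy]
    simp_rw [h1]
    rw [setIntegral_indicator measurableSet_Iio, Ioi_inter_Iio]
    have h2 : ∫ y in Ioo 0 R, y ^ 2 * y⁻¹ = ∫ y in Ioo 0 R, y := by
      refine setIntegral_congr_fun measurableSet_Ioo fun y hy => ?_
      have hy0 : y ≠ 0 := hy.1.ne'
      field_simp
    rw [h2, ← intervalIntegral.integral_of_le hR |>.trans (integral_Ioc_eq_integral_Ioo),
      integral_id]
    ring
  rw [hrad]
  simp only [nsmul_eq_mul, smul_eq_mul]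
  push_cast
  ring

/-- Translation: `∫_{B(x,R)} |x - y|⁻¹ dy = ∫_{B(0,R)} |z|⁻¹ dz`. [folklore] -/
theorem integral_inv_norm_sub_ball (x : Space) (R : ℝ) :
    ∫ y in ball x R, ‖x - y‖⁻¹ = ∫ z in ball (0 : Space) R, ‖z‖⁻¹ := by
  have hind : ∀ y : Space, (ball x R).indicator (fun y => ‖x - y‖⁻¹) y =
      (ball (0 : Space) R).indicator (fun z : Space => ‖z‖⁻¹) (y - x) := by
    intro y
    have hmem : y ∈ ball x R ↔ y - x ∈ ball (0 : Space) R := by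
      rw [mem_ball, mem_ball_zero_iff, dist_eq_norm]
    by_cases hy : y ∈ ball x R
    · rw [indicator_of_mem hy, indicator_of_mem (hmem.1 hy), norm_sub_rev]
    · rw [indicator_of_notMem hy, indicator_of_notMem (fun h => hy (hmem.2 h))]
  rw [← integral_indicator measurableSet_ball, ← integral_indicator measurableSet_ball]
  simp_rw [hind]
  exact integral_sub_right_eq_self (μ := (volume : Measure Space))
    (fun z => (ball (0 : Space) R).indicator (fun z : Space => ‖z‖⁻¹) z) x

/-- Translation: integrability of `|x - ·|⁻¹` on `B(x, R)`. [folklore] -/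
theorem integrableOn_inv_norm_sub_ball (x : Space) (R : ℝ) :
    IntegrableOn (fun y : Space => ‖x - y‖⁻¹) (ball x R) := by
  have hind : (ball x R).indicator (fun y => ‖x - y‖⁻¹) =
      fun y => (ball (0 : Space) R).indicator (fun z : Space => ‖z‖⁻¹) (y - x) := by
    funext y
    have hmem : y ∈ ball x R ↔ y - x ∈ ball (0 : Space) R := by
      rw [mem_ball, mem_ball_zero_iff, dist_eq_norm]
    by_cases hy : y ∈ ball x R
    · rw [indicator_of_mem hy, indicator_of_mem (hmem.1 hy), norm_sub_rev]
    · rw [indicator_of_notMem hy, indicator_of_notMem (fun h => hy (hmem.2 h))]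
  rw [← integrable_indicator_iff measurableSet_ball, hind]
  exact ((integrable_indicator_iff measurableSet_ball).2 (integrableOn_inv_norm_ball R)
    ).comp_sub_right x

/-- Two points of the box `Λ_L = (0, L)³` are at distance `< √3 · L`. [folklore] -/
theorem dist_lt_of_mem_box {L : ℝ} {x y : Space} (hx : x ∈ box L) (hy : y ∈ box L) :
    dist x y < Real.sqrt 3 * L := by
  have hL : 0 < L := by have := (hx 0).1; have := (hx 0).2; linarith
  have hk : ∀ k, dist (x k) (y k) ^ 2 < L ^ 2 := by
    intro k
    have h1 := hx k; have h2 := hy k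
    have : |x k - y k| < L := by rw [abs_lt]; constructor <;> linarith [h1.1, h1.2, h2.1, h2.2]
    rw [Real.dist_eq]
    exact (sq_lt_sq' (by linarith [abs_nonneg (x k - y k), (abs_lt.1 this).1]) this).trans_eq'
      (by rw [sq_abs]) |>.trans_eq rfl
  rw [EuclideanSpace.dist_eq]
  have hsum : ∑ k : Fin 3, dist (x k) (y k) ^ 2 < 3 * L ^ 2 := by
    calc ∑ k : Fin 3, dist (x k) (y k) ^ 2 < ∑ _k : Fin 3, L ^ 2 :=
          Finset.sum_lt_sum_of_nonempty Finset.univ_nonempty fun k _ => hk k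
      _ = 3 * L ^ 2 := by simp
  calc Real.sqrt (∑ k : Fin 3, dist (x k) (y k) ^ 2) < Real.sqrt (3 * L ^ 2) :=
        Real.sqrt_lt_sqrt (Finset.sum_nonneg fun k _ => sq_nonneg _) hsum
    _ = Real.sqrt 3 * L := by
        rw [Real.sqrt_mul (by norm_num : (0 : ℝ) ≤ 3), Real.sqrt_sq hL.le]

/-- The background potential is nonnegative. [cite: LSSY2005, Ch. 10 (10.1)] -/
theorem backgroundPotential_nonneg (L : ℝ) (x : Space) : 0 ≤ backgroundPotential L x :=
  integral_nonneg fun _ => inv_nonneg.2 (norm_nonneg _)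

/-- The Coulomb singularity is integrable on the box, about any centre. [folklore] -/
theorem integrableOn_inv_norm_sub_box (x : Space) (L : ℝ) :
    IntegrableOn (fun y : Space => ‖x - y‖⁻¹) (box L) := by
  refine (integrableOn_inv_norm_sub_ball x (‖x‖ + 3 * |L| + 1)).mono_set fun y hy => ?_
  rw [mem_ball, dist_eq_norm]
  calc ‖y - x‖ ≤ ‖y‖ + ‖x‖ := norm_sub_le _ _
    _ ≤ 3 * |L| + ‖x‖ := by gcongr; exact norm_le_of_mem_box hy
    _ < ‖x‖ + 3 * |L| + 1 := by linarith

/-- **`V₁ ≤ 6πL²` on the box.** For `x ∈ Λ_L`, `∫_{Λ_L} |x - y|⁻¹ dy ≤ 6π L²`, since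
`Λ_L ⊂ B(x, √3 L)` and `∫_{B(x,R)} |x - y|⁻¹ dy = 2π R²`. This is the bound that makes every
one-body term of `jelliumInteraction` nonnegative where a trial state lives.
[cite: LSSY2005, Ch. 10 (10.1)] -/
theorem backgroundPotential_le {L : ℝ} {x : Space} (hx : x ∈ box L) :
    backgroundPotential L x ≤ 6 * Real.pi * L ^ 2 := by
  have hL : 0 < L := by have := (hx 0).1; have := (hx 0).2; linarith
  set R : ℝ := Real.sqrt 3 * L with hR
  have hR0 : 0 ≤ R := by positivity
  have hR2 : R ^ 2 = 3 * L ^ 2 := by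
    rw [hR, mul_pow, Real.sq_sqrt (by norm_num : (0 : ℝ) ≤ 3)]
  calc backgroundPotential L x = ∫ y in box L, ‖x - y‖⁻¹ := rfl
    _ ≤ ∫ y in ball x R, ‖x - y‖⁻¹ := by
        refine setIntegral_mono_set (integrableOn_inv_norm_sub_ball x R) ?_
          (Eventually.of_forall fun y hy => ?_)
        · exact Eventually.of_forall fun y => inv_nonneg.2 (norm_nonneg _)
        · show y ∈ ball x R
          rw [mem_ball, dist_comm]
          exact dist_lt_of_mem_box hx hy
    _ = 2 * Real.pi * R ^ 2 := by rw [integral_inv_norm_sub_ball, integral_inv_norm_ball hR0]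
    _ = 6 * Real.pi * L ^ 2 := by rw [hR2]; ring

/-- On the box every one-body term of `jelliumInteraction` is unclipped:
`0 ≤ ρ_b (6πL² - V₁(x))` for `x ∈ Λ_L`, `ρ_b ≥ 0`. [cite: LSSY2005, Ch. 10 (10.1)] -/
theorem oneBody_nonneg {ρb L : ℝ} (hρ : 0 ≤ ρb) {x : Space} (hx : x ∈ box L) :
    0 ≤ ρb * (6 * Real.pi * L ^ 2 - backgroundPotential L x) :=
  mul_nonneg hρ (sub_nonneg.2 (backgroundPotential_le hx))

/-- **No clipping on `Λ^N`.** For a configuration in the box and `ρ_b ≥ 0`, the `ℝ≥0∞`-valued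
jellium energy is `ofReal` of the real (shifted) Coulomb energy
`∑_{i<j} |xᵢ - xⱼ|⁻¹ + ∑ᵢ ρ_b (6πL² - V₁(xᵢ))
 = U(X) - C + 6π ρ_b N L²`, `U` the Coulomb energy of (10.1) at unit charge,
`C = backgroundSelfEnergy ρ_b L`. [cite: LSSY2005, Ch. 10 (10.1)] -/
theorem jelliumInteraction_eq_ofReal {ρb L : ℝ} (hρ : 0 ≤ ρb) {N : ℕ} {X : Config N}
    (hX : X ∈ boxN N L) :
    jelliumInteraction ρb N L X = ENNReal.ofReal
      ((∑ i : Fin N, ∑ j : Fin N with i < j, ‖X i - X j‖⁻¹) +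
        ∑ i : Fin N, ρb * (6 * Real.pi * L ^ 2 - backgroundPotential L (X i))) := by
  rw [jelliumInteraction_eq, ENNReal.ofReal_add (Finset.sum_nonneg fun i _ =>
      Finset.sum_nonneg fun j _ => inv_nonneg.2 (norm_nonneg _))
      (Finset.sum_nonneg fun i _ => oneBody_nonneg hρ (hX i)),
    ENNReal.ofReal_sum_of_nonneg (fun i _ => Finset.sum_nonneg fun j _ =>
      inv_nonneg.2 (norm_nonneg _)),
    ENNReal.ofReal_sum_of_nonneg (fun i _ => oneBody_nonneg hρ (hX i))]
  congr 1
  exact Finset.sum_congr rfl fun i _ =>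
    (ENNReal.ofReal_sum_of_nonneg fun j _ => inv_nonneg.2 (norm_nonneg _)).symm

/-- The real shifted Coulomb energy in terms of LSSY's `U` (10.1) at unit charge and the tree's
shift: `∑_{i<j}|xᵢ-xⱼ|⁻¹ + ∑ᵢ ρ_b(6πL² - V₁(xᵢ)) = U(X) + jelliumEnergyShift 1 ρ_b N L` where
`U(X) = ∑_{i<j}|xᵢ-xⱼ|⁻¹ - ρ_b ∑ᵢ V₁(xᵢ) + C`, `C = backgroundSelfEnergy ρ_b L`. [cite: LSSY2005, Ch. 10 (10.1)] -/
theorem shiftedCoulomb_eq {ρb L : ℝ} {N : ℕ} (X : Config N) :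
    (∑ i : Fin N, ∑ j : Fin N with i < j, ‖X i - X j‖⁻¹) +
        ∑ i : Fin N, ρb * (6 * Real.pi * L ^ 2 - backgroundPotential L (X i)) =
      ((∑ i : Fin N, ∑ j : Fin N with i < j, ‖X i - X j‖⁻¹) -
          ρb * ∑ i : Fin N, backgroundPotential L (X i) + backgroundSelfEnergy ρb L) +
        jelliumEnergyShift 1 ρb N L := by
  have h1 : ∑ i : Fin N, ρb * (6 * Real.pi * L ^ 2 - backgroundPotential L (X i)) =
      (N : ℝ) * (ρb * (6 * Real.pi * L ^ 2)) - ρb * ∑ i : Fin N, backgroundPotential L (X i) := by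
    simp_rw [mul_sub]
    rw [Finset.sum_sub_distrib, Finset.sum_const, Finset.card_univ, Fintype.card_fin,
      nsmul_eq_mul, Finset.mul_sum]
  rw [h1, jelliumEnergyShift]
  ring

end Background

/-! ### Foldy's law = finite-volume lower bound ∧ finite-volume upper bound -/

/-- **`foldyLaw` splits into its two halves, with no thermodynamic limit needed.** The
`ε`–`ρ₀`–eventually-in-`N` statement `foldyLaw` is equivalent to the conjunction of
(lower) for every `q > 0`, `ε > 0` there is `ρ₀ > 0` such that for `ρ ≥ ρ₀`, eventually in `N`,
`E₀(N, L)/N ≥ (-foldyConstant · q^{5/4} - ε) ρ^{1/4}` — the shape of the Lieb–Solovej lower bound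
[LiebSolovej2001, Thm. 1.1], which is proved in finite volume — and (upper) the same with
`E₀(N, L)/N ≤ (-foldyConstant · q^{5/4} + ε) ρ^{1/4}` — the shape of Solovej's variational upper
bound [Solovej2006, Thm. 1.1]; here `E₀(N, L) = chargedGroundStateEnergy - jelliumEnergyShift`,
`L = (N/ρ)^{1/3}`, finite by `eventually_chargedGroundStateEnergy_ne_top`. So `foldyLaw_holds`
needs exactly these two finite-volume bounds (the existence of the limit (2.2),
[LiebNarnhofer1975], is not needed for the `ε`-form). [cite: LSSY2005, Thm. 10.1] -/
theorem foldyLaw_iff_bounds :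
    foldyLaw ↔
      ((∀ q : ℝ, 0 < q → ∀ ε : ℝ, 0 < ε → ∃ ρ₀ : ℝ, 0 < ρ₀ ∧ ∀ ρ : ℝ, ρ₀ ≤ ρ →
          ∀ᶠ N : ℕ in atTop,
            (-(foldyConstant * q ^ (5 / 4 : ℝ)) - ε) * ρ ^ (1 / 4 : ℝ) ≤
              ((chargedGroundStateEnergy 0 q ρ N (sideLength ρ N)).toReal -
                  jelliumEnergyShift q ρ N (sideLength ρ N)) / N) ∧
        ∀ q : ℝ, 0 < q → ∀ ε : ℝ, 0 < ε → ∃ ρ₀ : ℝ, 0 < ρ₀ ∧ ∀ ρ : ℝ, ρ₀ ≤ ρ →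
          ∀ᶠ N : ℕ in atTop,
            ((chargedGroundStateEnergy 0 q ρ N (sideLength ρ N)).toReal -
                  jelliumEnergyShift q ρ N (sideLength ρ N)) / N ≤
              (-(foldyConstant * q ^ (5 / 4 : ℝ)) + ε) * ρ ^ (1 / 4 : ℝ)) := by
  constructor
  · intro h
    refine ⟨fun q hq ε hε => ?_, fun q hq ε hε => ?_⟩
    · obtain ⟨ρ₀, hρ₀, hρ⟩ := h q hq ε hε
      refine ⟨ρ₀, hρ₀, fun ρ hle => ?_⟩
      filter_upwards [hρ ρ hle] with N hN
      have := (abs_le.1 hN.2).1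
      linarith
    · obtain ⟨ρ₀, hρ₀, hρ⟩ := h q hq ε hε
      refine ⟨ρ₀, hρ₀, fun ρ hle => ?_⟩
      filter_upwards [hρ ρ hle] with N hN
      have := (abs_le.1 hN.2).2
      linarith
  · rintro ⟨hlow, hup⟩ q hq ε hε
    obtain ⟨ρ₁, hρ₁, h₁⟩ := hlow q hq ε hε
    obtain ⟨ρ₂, -, h₂⟩ := hup q hq ε hε
    refine ⟨max ρ₁ ρ₂, lt_max_of_lt_left hρ₁, fun ρ hρ => ?_⟩
    have hρ0 : 0 < ρ := hρ₁.trans_le ((le_max_left _ _).trans hρ)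
    filter_upwards [h₁ ρ ((le_max_left _ _).trans hρ), h₂ ρ ((le_max_right _ _).trans hρ),
      eventually_chargedGroundStateEnergy_ne_top hρ0 q] with N hl hu hfin
    refine ⟨hfin, abs_le.2 ⟨?_, ?_⟩⟩
    · linarith
    · linarith

/-- In particular the two finite-volume bounds give Foldy's law. [cite: LSSY2005, Thm. 10.1] -/
theorem foldyLaw_of_bounds
    (hlow : ∀ q : ℝ, 0 < q → ∀ ε : ℝ, 0 < ε → ∃ ρ₀ : ℝ, 0 < ρ₀ ∧ ∀ ρ : ℝ, ρ₀ ≤ ρ →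
      ∀ᶠ N : ℕ in atTop,
        (-(foldyConstant * q ^ (5 / 4 : ℝ)) - ε) * ρ ^ (1 / 4 : ℝ) ≤
          ((chargedGroundStateEnergy 0 q ρ N (sideLength ρ N)).toReal -
              jelliumEnergyShift q ρ N (sideLength ρ N)) / N)
    (hup : ∀ q : ℝ, 0 < q → ∀ ε : ℝ, 0 < ε → ∃ ρ₀ : ℝ, 0 < ρ₀ ∧ ∀ ρ : ℝ, ρ₀ ≤ ρ →
      ∀ᶠ N : ℕ in atTop,
        ((chargedGroundStateEnergy 0 q ρ N (sideLength ρ N)).toReal -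
              jelliumEnergyShift q ρ N (sideLength ρ N)) / N ≤
          (-(foldyConstant * q ^ (5 / 4 : ℝ)) + ε) * ρ ^ (1 / 4 : ℝ)) :
    foldyLaw :=
  foldyLaw_iff_bounds.2 ⟨hlow, hup⟩

end Literature.MathematicalPhysics.QuantumManyBody.JelliumBoseGas
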